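import Mathlib
import Literature.Computability.AlgebraicComplexity.FixedPointLog
import Summits.RiemannHypothesis.RiemannHypothesis.Theorems.IntegerScrewRungCertDefs
import Summits.RiemannHypothesis.RiemannHypothesis.Theorems.WeilFarFloorLowerBounds
import HarnessLib

/-!
# Kernel LOWER bounds of the far (prime-shift) constant — further windows

Helper file (`--supports stmt-RiemannHypothesis-0098`, lead-track anchor: Weil-positivity window ladder, format-C far bound),
RH-free, pure proofs; continuation of `WeilFarFloorLowerBounds` (step-test lemma `FloorLower.shiftBound_stepTest`, monotone evaluation,
certified log brackets).  Seat rh-explicit-weil-1 gen8 (memo FORMAT-K3.md §9).  Numbers (L ≤ floor λ_max (float) ≤ landed/staged A):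
a = 83/100: 1255/1000 ≤ 1.471 ≤ `primeCoeff_form_ge_cells_083` 1574/1000 (p352436) · a = 9/10: 1524/1000 ≤ 1.66 ≤ `primeCoeff_form_ge_cells_09` 1730/1000 · a = 9729/10000: 1718/1000 ≤ 1.779 ≤ `primeCoeff_form_ge_cells_09729` 1825/1000.
Standard axioms only.
-/

set_option linter.dupNamespace false
set_option autoImplicit false

noncomputable section

open MeasureTheory Set Finset
open scoped Real BigOperators ArithmeticFunction.vonMangoldt

namespace Summit.RiemannHypothesis.RiemannHypothesis.Theorems.WeilFormatC

namespace FloorLower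
/-! ### The windows: two-step even test functions -/
/-- **Far-constant floor from below at `a = 83/100`** (`e^(2a) ≤ 6`): every uniform shift bound `A` of the
window `[−83/100, 83/100]` in the range-`6` form satisfies `1255/1000 ≤ A` (two-step test: edge bands of width `1/20`,
height `27/10`; certified value `1.25511`; upper side: `primeCoeff_form_ge_cells_083` 1574/1000 (p352436)). -/
theorem le_of_shiftBound_range6_083 {A : ℝ}
    (hJ : ∀ (f : ℝ → ℝ) (C : ℝ), Measurable f → (∀ x, |f x| ≤ C) →
      (∀ x, x ∉ Icc (-(83 / 100 : ℝ)) (83 / 100 : ℝ) → f x = 0) →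
      ∑ n ∈ Finset.range 6, 2 * ((Λ n : ℝ) / Real.sqrt n) * (∫ x, f (x - Real.log n) * f x) ≤ A * ∫ x, f x ^ 2) :
    (1255 / 1000 : ℝ) ≤ A := by
  set α := (![-(83 / 100), -(39 / 50), 39 / 50] : Fin 3 → ℝ) with hα
  set β := (![-(39 / 50), 39 / 50, 83 / 100] : Fin 3 → ℝ) with hβ
  set c := (![27 / 10, 1, 27 / 10] : Fin 3 → ℝ) with hc
  have hc0 : ∀ i, 0 ≤ c i := by intro i; fin_cases i <;> norm_num [hc]
  have h := shiftBound_stepTest (Finset.range 6) (fun n : ℕ ↦ 2 * ((Λ n : ℝ) / Real.sqrt n))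
    (fun n : ℕ ↦ Real.log n) α β c (by intro i; fin_cases i <;> norm_num [hα, hβ]) hJ
  have t2 := stepOverlap_mono α β c hc0 (u := Real.log 2) (v := 11368528099 / 10000000000) br_2.1 br_2.2.1
    (weight_lower br_2.1 (by norm_num) (by norm_num) br_2.2.2) (by norm_num)
    (by simp only [hα, hβ, hc, Fin.sum_univ_succ, Fin.sum_univ_zero, Matrix.cons_val_zero, Matrix.cons_val_succ]; norm_num [max_def, min_def])
  have t3 := stepOverlap_mono α β c hc0 (u := Real.log 3) (v := 7313877019 / 10000000000) br_3.1 br_3.2.1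
    (weight_lower br_3.1 (by norm_num) (by norm_num) br_3.2.2) (by norm_num)
    (by simp only [hα, hβ, hc, Fin.sum_univ_succ, Fin.sum_univ_zero, Matrix.cons_val_zero, Matrix.cons_val_succ]; norm_num [max_def, min_def])
  have t4 := stepOverlap_mono α β c hc0 (u := Real.log 4) (v := 4437056289 / 10000000000) br_4.1 br_4.2.1
    (weight_lower br_2.1 (by norm_num) (by norm_num) br_4.2.2) (by norm_num)
    (by simp only [hα, hβ, hc, Fin.sum_univ_succ, Fin.sum_univ_zero, Matrix.cons_val_zero, Matrix.cons_val_succ]; norm_num [max_def, min_def])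
  have t5 := stepOverlap_mono α β c hc0 (u := Real.log 5) (v := 36343763559 / 100000000000) br_5.1 br_5.2.1
    (weight_lower br_5.1 (by norm_num) (by norm_num) br_5.2.2) (by norm_num)
    (by simp only [hα, hβ, hc, Fin.sum_univ_succ, Fin.sum_univ_zero, Matrix.cons_val_zero, Matrix.cons_val_succ]; norm_num [max_def, min_def])
  set Ψ := (fun s t : ℝ ↦ ∑ i, ∑ j, c i * c j * max (min (β i + s) (β j) - max (α i + t) (α j)) 0) with hΨ
  simp only [Finset.sum_range_succ, Finset.sum_range_zero, vm_0, vm_1, vm_2, vm_3, vm_4, vm_5,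
    Nat.cast_ofNat, Nat.cast_one, Nat.cast_zero, zero_div, mul_zero, zero_mul, zero_add, add_zero] at h
  have e0 : Ψ 0 0 = (2289 / 1000 : ℝ) := by
    simp only [hΨ, hα, hβ, hc, Fin.sum_univ_succ, Fin.sum_univ_zero, Matrix.cons_val_zero, Matrix.cons_val_succ]
    norm_num [max_def, min_def]
  rw [e0] at h
  linarith [t2, t3, t4, t5]
/-- **Far-constant floor from below at `a = 9/10`** (`e^(2a) ≤ 7`): every uniform shift bound `A` of the
window `[−9/10, 9/10]` in the range-`7` form satisfies `1524/1000 ≤ A` (two-step test: edge bands of width `19/100`,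
height `9/5`; certified value `1.52472`; upper side: `primeCoeff_form_ge_cells_09` 1730/1000). -/
theorem le_of_shiftBound_range7_09 {A : ℝ}
    (hJ : ∀ (f : ℝ → ℝ) (C : ℝ), Measurable f → (∀ x, |f x| ≤ C) →
      (∀ x, x ∉ Icc (-(9 / 10 : ℝ)) (9 / 10 : ℝ) → f x = 0) →
      ∑ n ∈ Finset.range 7, 2 * ((Λ n : ℝ) / Real.sqrt n) * (∫ x, f (x - Real.log n) * f x) ≤ A * ∫ x, f x ^ 2) :
    (1524 / 1000 : ℝ) ≤ A := by
  set α := (![-(9 / 10), -(71 / 100), 71 / 100] : Fin 3 → ℝ) with hα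
  set β := (![-(71 / 100), 71 / 100, 9 / 10] : Fin 3 → ℝ) with hβ
  set c := (![9 / 5, 1, 9 / 5] : Fin 3 → ℝ) with hc
  have hc0 : ∀ i, 0 ≤ c i := by intro i; fin_cases i <;> norm_num [hc]
  have h := shiftBound_stepTest (Finset.range 7) (fun n : ℕ ↦ 2 * ((Λ n : ℝ) / Real.sqrt n))
    (fun n : ℕ ↦ Real.log n) α β c (by intro i; fin_cases i <;> norm_num [hα, hβ]) hJ
  have t2 := stepOverlap_mono α β c hc0 (u := Real.log 2) (v := 7054264063 / 5000000000) br_2.1 br_2.2.1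
    (weight_lower br_2.1 (by norm_num) (by norm_num) br_2.2.2) (by norm_num)
    (by simp only [hα, hβ, hc, Fin.sum_univ_succ, Fin.sum_univ_zero, Matrix.cons_val_zero, Matrix.cons_val_succ]; norm_num [max_def, min_def])
  have t3 := stepOverlap_mono α β c hc0 (u := Real.log 3) (v := 5026938523 / 5000000000) br_3.1 br_3.2.1
    (weight_lower br_3.1 (by norm_num) (by norm_num) br_3.2.2) (by norm_num)
    (by simp only [hα, hβ, hc, Fin.sum_univ_succ, Fin.sum_univ_zero, Matrix.cons_val_zero, Matrix.cons_val_succ]; norm_num [max_def, min_def])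
  have t4 := stepOverlap_mono α β c hc0 (u := Real.log 4) (v := 1794264079 / 2500000000) br_4.1 br_4.2.1
    (weight_lower br_2.1 (by norm_num) (by norm_num) br_4.2.2) (by norm_num)
    (by simp only [hα, hβ, hc, Fin.sum_univ_succ, Fin.sum_univ_zero, Matrix.cons_val_zero, Matrix.cons_val_succ]; norm_num [max_def, min_def])
  have t5 := stepOverlap_mono α β c hc0 (u := Real.log 5) (v := 15395058531 / 25000000000) br_5.1 br_5.2.1
    (weight_lower br_5.1 (by norm_num) (by norm_num) br_5.2.2) (by norm_num)
    (by simp only [hα, hβ, hc, Fin.sum_univ_succ, Fin.sum_univ_zero, Matrix.cons_val_zero, Matrix.cons_val_succ]; norm_num [max_def, min_def])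
  set Ψ := (fun s t : ℝ ↦ ∑ i, ∑ j, c i * c j * max (min (β i + s) (β j) - max (α i + t) (α j)) 0) with hΨ
  simp only [Finset.sum_range_succ, Finset.sum_range_zero, vm_0, vm_1, vm_2, vm_3, vm_4, vm_5, vm_6,
    Nat.cast_ofNat, Nat.cast_one, Nat.cast_zero, zero_div, mul_zero, zero_mul, zero_add, add_zero] at h
  have e0 : Ψ 0 0 = (1657 / 625 : ℝ) := by
    simp only [hΨ, hα, hβ, hc, Fin.sum_univ_succ, Fin.sum_univ_zero, Matrix.cons_val_zero, Matrix.cons_val_succ]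
    norm_num [max_def, min_def]
  rw [e0] at h
  linarith [t2, t3, t4, t5]
/-- **Far-constant floor from below at `a = 9729/10000`** (`e^(2a) ≤ 7`): every uniform shift bound `A` of the
window `[−9729/10000, 9729/10000]` in the range-`7` form satisfies `1718/1000 ≤ A` (two-step test: edge bands of width `67/200`,
height `31/20`; certified value `1.71816`; upper side: `primeCoeff_form_ge_cells_09729` 1825/1000). -/
theorem le_of_shiftBound_range7_09729 {A : ℝ}
    (hJ : ∀ (f : ℝ → ℝ) (C : ℝ), Measurable f → (∀ x, |f x| ≤ C) →
      (∀ x, x ∉ Icc (-(9729 / 10000 : ℝ)) (9729 / 10000 : ℝ) → f x = 0) →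
      ∑ n ∈ Finset.range 7, 2 * ((Λ n : ℝ) / Real.sqrt n) * (∫ x, f (x - Real.log n) * f x) ≤ A * ∫ x, f x ^ 2) :
    (1718 / 1000 : ℝ) ≤ A := by
  set α := (![-(9729 / 10000), -(6379 / 10000), 6379 / 10000] : Fin 3 → ℝ) with hα
  set β := (![-(6379 / 10000), 6379 / 10000, 9729 / 10000] : Fin 3 → ℝ) with hβ
  set c := (![31 / 20, 1, 31 / 20] : Fin 3 → ℝ) with hc
  have hc0 : ∀ i, 0 ≤ c i := by intro i; fin_cases i <;> norm_num [hc]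
  have h := shiftBound_stepTest (Finset.range 7) (fun n : ℕ ↦ 2 * ((Λ n : ℝ) / Real.sqrt n))
    (fun n : ℕ ↦ Real.log n) α β c (by intro i; fin_cases i <;> norm_num [hα, hβ]) hJ
  have t2 := stepOverlap_mono α β c hc0 (u := Real.log 2) (v := 32423056267 / 20000000000) br_2.1 br_2.2.1
    (weight_lower br_2.1 (by norm_num) (by norm_num) br_2.2.2) (by norm_num)
    (by simp only [hα, hβ, hc, Fin.sum_univ_succ, Fin.sum_univ_zero, Matrix.cons_val_zero, Matrix.cons_val_succ]; norm_num [max_def, min_def])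
  have t3 := stepOverlap_mono α β c hc0 (u := Real.log 3) (v := 24313754107 / 20000000000) br_3.1 br_3.2.1
    (weight_lower br_3.1 (by norm_num) (by norm_num) br_3.2.2) (by norm_num)
    (by simp only [hα, hβ, hc, Fin.sum_univ_succ, Fin.sum_univ_zero, Matrix.cons_val_zero, Matrix.cons_val_succ]; norm_num [max_def, min_def])
  have t4 := stepOverlap_mono α β c hc0 (u := Real.log 4) (v := 4807150873 / 5000000000) br_4.1 br_4.2.1
    (weight_lower br_2.1 (by norm_num) (by norm_num) br_4.2.2) (by norm_num)
    (by simp only [hα, hβ, hc, Fin.sum_univ_succ, Fin.sum_univ_zero, Matrix.cons_val_zero, Matrix.cons_val_succ]; norm_num [max_def, min_def])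
  have t5 := stepOverlap_mono α β c hc0 (u := Real.log 5) (v := 322315019111 / 400000000000) br_5.1 br_5.2.1
    (weight_lower br_5.1 (by norm_num) (by norm_num) br_5.2.2) (by norm_num)
    (by simp only [hα, hβ, hc, Fin.sum_univ_succ, Fin.sum_univ_zero, Matrix.cons_val_zero, Matrix.cons_val_succ]; norm_num [max_def, min_def])
  set Ψ := (fun s t : ℝ ↦ ∑ i, ∑ j, c i * c j * max (min (β i + s) (β j) - max (α i + t) (α j)) 0) with hΨ
  simp only [Finset.sum_range_succ, Finset.sum_range_zero, vm_0, vm_1, vm_2, vm_3, vm_4, vm_5, vm_6,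
    Nat.cast_ofNat, Nat.cast_one, Nat.cast_zero, zero_div, mul_zero, zero_mul, zero_add, add_zero] at h
  have e0 : Ψ 0 0 = (115419 / 40000 : ℝ) := by
    simp only [hΨ, hα, hβ, hc, Fin.sum_univ_succ, Fin.sum_univ_zero, Matrix.cons_val_zero, Matrix.cons_val_succ]
    norm_num [max_def, min_def]
  rw [e0] at h
  linarith [t2, t3, t4, t5]
end FloorLower

end Summit.RiemannHypothesis.RiemannHypothesis.Theorems.WeilFormatC
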